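import Summits.Langlands.Langlands.Theses.DyadicOddResidue
import Summits.Langlands.Langlands.Theses.OddResidueBelowFive
import Literature.NumberTheory.Automorphic.FontaineMazurGL2OddPrimeTateTwist
import Literature.NumberTheory.Automorphic.SerreConjecture
import Literature.NumberTheory.GaloisRepresentations.ResidualGaloisRep
import Literature.NumberTheory.GaloisRepresentations.ProjectiveType
import HarnessLib

/-!
# Sketch (crux-ideate, round 1, ideator k = 1) — crux `DyadicOddResidue.DyadicNonsolvableFM`
# (item stmt-Langlands-18744): the TATE-TWIST CELL TRANSPLANT

Idea card `tate-twist-cell-transplant`.  Everything here elaborates; `sorry` occurs only in the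
two stubs `stub_regularFMCellOn_of_tateTwistModularityOn` (S: the landed odd-prime conversion
with its `ℓ ≠ 2` guard replaced by an arbitrary cell predicate) and
`stub_isResiduallySerreModular_of_khare_wintenberger` (M: the Khare–Wintenberger residual bridge
at `p = 2`).  The glue `dyadicNonsolvableFM_of_line` concluding the crux BY NAME, the cell
re-indexings `dyadicNonsolvableFM_iff` / `oddPrimesRegularFM_iff` (cross-check against the LANDED odd-prime conversion: `SketchCrossCheck.lean`), the
"non-solvability certifies the chosen residual representation" lemma, oddness-for-free in
characteristic `2`, and the twin comparison with `OddResidueBelowFive.KnownTwoAdicBigImage` are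
PROVED (pure logic / two-line algebra).
-/

noncomputable section

open scoped MatrixGroups Matrix NumberField ModularForm Polynomial
open NumberField IsDedekindDomain Field Filter CongruenceSubgroup
open Literature.NumberTheory Literature.NumberTheory.Automorphic
  Literature.NumberTheory.EllipticCurves.ModularForms Literature.NumberTheory.GaloisRepresentations

namespace Summit.Langlands.Langlands.Cruxes.DyadicNonsolvableFM.TateTwistCellTransplant

set_option linter.dupNamespace false -- `Summit.Langlands.Langlands` is the mandated namespace

open Summit.Langlands.Langlands.Theses

/-! ## 1. The two cell-uniform statements -/

/-- A CELL of the regular Fontaine–Mazur problem over `ℚ`: a predicate on `(ℓ, ρ)`. -/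
abbrev CellPred : Type :=
  ∀ (ℓ : ℕ) [Fact ℓ.Prime], FramedGaloisRep ℚ (PadicAlgCl ℓ) 2 → Prop

/-- **Tate-twist newform modularity on the cell `P`** (Galois side only; the common shape of the
vendored facts `XZhang2024_fontaineMazurGL2_tateTwist` (cell `ℓ ≠ 2`) and of the proposed
`Tung2020_fontaineMazurGL2_two_tateTwist` (cell `ℓ = 2 ∧ ρ̄ non-solvable`)): every `ρ` in the
cell which is a.e. unramified, irreducible, odd, de Rham at `ℓ` (pinned datum) with distinct
labelled Hodge–Tate weights has a Tate twist `ρ ⊗ ε_ℓ^m` attached to a newform away from `N ℓ`. -/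
def TateTwistModularityOn (P : CellPred) : Prop :=
  ∀ (p : ℕ) [Fact p.Prime] (ρ : FramedGaloisRep ℚ (PadicAlgCl p) 2), P p ρ →
    (∀ᶠ v : HeightOneSpectrum (𝓞 ℚ) in cofinite, ρ.IsUnramifiedAt v) →
    ρ.toGaloisRep.IsIrreducible → ρ.IsOdd →
    (∀ (v : HeightOneSpectrum (𝓞 ℚ)) (hv : ((p : ℕ) : 𝓞 ℚ) ∈ v.asIdeal),
      (PAdicHodge.fontainePstAdicCompletion v p hv).IsDeRhamFramed (ρ.toLocal v) ∧
      ∀ τ : v.adicCompletion ℚ →+* PadicAlgCl p, Continuous τ →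
        (ρ.labelledHodgeTateWeightsAt v (PAdicHodge.fontainePstAdicCompletion v p hv).algebra
          (PAdicHodge.fontainePstAdicCompletion v p hv).𝔅 τ).Nodup) →
    ∃ (χ : absoluteGaloisGroup ℚ →ₜ* (PadicAlgCl p)ˣ) (m : ℤ),
      (∀ σ, χ σ = cyclotomicPadicAlgCl ℚ p σ ^ m) ∧
      ∃ (N : ℕ) (_ : NeZero N) (k : ℤ) (f : CuspForm (Gamma1 N) k)
        (ιf : coeffCharField f →+* PadicAlgCl p),
        IsNewform1 f ∧ IsGaloisRepOfNewform1 f ιf {q | q ∣ N * p} (FramedRep.twist ρ χ)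

/-- **The summit's regular Fontaine–Mazur cell on `P`** (automorphic side): the common shape of
ALL statement items of routes `DyadicOddResidue` / `OddResidueBelowFive` (target, the two open
cruxes, the two printed supports), with the binder order of the route decls. -/
def RegularFMCellOn (P : CellPred) : Prop :=
  ∀ (ℓ : ℕ) [Fact ℓ.Prime] (ρ : FramedGaloisRep ℚ (PadicAlgCl ℓ) 2), P ℓ ρ →
    ρ.toGaloisRep.IsIrreducible → ρ.IsOdd →
    (∀ᶠ v : HeightOneSpectrum (𝓞 ℚ) in cofinite, ρ.IsUnramifiedAt v) →
    (∀ (v : HeightOneSpectrum (𝓞 ℚ)) (hv : ((ℓ : ℕ) : 𝓞 ℚ) ∈ v.asIdeal),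
      (PAdicHodge.fontainePstAdicCompletion v ℓ hv).IsDeRhamFramed (ρ.toLocal v) ∧
      ∀ τ : v.adicCompletion ℚ →+* PadicAlgCl ℓ, Continuous τ →
        (ρ.labelledHodgeTateWeightsAt v (PAdicHodge.fontainePstAdicCompletion v ℓ hv).algebra
          (PAdicHodge.fontainePstAdicCompletion v ℓ hv).𝔅 τ).Nodup) →
    ∀ (hcpt : isCompact_glFiniteIntegralLevel 2 ℚ) (ι : PadicAlgCl ℓ ≃+* ℂ),
      ∃ π : CuspidalAutomorphicRepData 2 ℚ hcpt, π.1.IsLAlgebraic ∧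
        ∀ᶠ v : HeightOneSpectrum (𝓞 ℚ) in cofinite, Summit.Langlands.SatakeFrobCompatibleAt ι π.1 ρ v

/-- The cell of THIS crux: `ℓ = 2`, `ρ̄` absolutely irreducible with non-solvable image. -/
def dyadicNonsolvablePred : CellPred := fun ℓ _ ρ =>
  ℓ = 2 ∧ ρ.IsResiduallyAbsIrreducible ∧ ¬ IsSolvable ρ.residualRep.range

/-- The cell of the sibling support `OddPrimesRegularFM`: `ℓ ≠ 2`. -/
def oddPrimePred : CellPred := fun ℓ _ _ => ℓ ≠ 2

/-! ## 2. FIRST LEMMA of the line (stub, size S): the p-UNIFORM conversion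

Proof = the landed `Summit.Langlands.Langlands.Theorems.oddPrimesRegularFM_of_tateTwistModularity`
(Theorems/DyadicOddResidueOddPrimesRegularFM.lean, 62 tactic lines) with its guard `hℓ : ℓ ≠ 2`
replaced by `hP : P ℓ ρ` — that proof uses `hℓ` ONLY to feed the hypothesis; every lemma it calls
(`exists_isLAlgebraic_hasSatakeParamAt_rootsInv_of_isNewform1`, `exists_twist_hasInfinityType`,
`HasSatakeParamAt.of_map_mulChar_detTwist_of_cpow`, `cyclotomicPadicAlgCl_eq_one_of_mem_inertia`,
`coe_cyclotomicPadicAlgCl_of_isArithFrobAt`, `charpoly_eq_of_charpoly_twist_eq`,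
`arithFrobPolyOfSatake_one_rootsInv_smul`) is prime-agnostic. -/
theorem stub_regularFMCellOn_of_tateTwistModularityOn (P : CellPred) :
    TateTwistModularityOn P → RegularFMCellOn P := by
  sorry

/-! ## 3. Re-indexing the route decls as cells (PROVED, pure logic) -/

/-- The crux IS the regular FM cell on `dyadicNonsolvablePred` (binder shuffle). -/
theorem dyadicNonsolvableFM_iff :
    DyadicOddResidue.DyadicNonsolvableFM ↔ RegularFMCellOn dyadicNonsolvablePred := by
  constructor
  · intro h ℓ _ ρ hP hirr hodd hunr hdR hcpt ι
    exact h ℓ hP.1 ρ hP.2.1 hP.2.2 hirr hodd hunr hdR hcpt ι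
  · intro h ℓ _ hℓ ρ hres hns hirr hodd hunr hdR hcpt ι
    exact h ℓ ρ ⟨hℓ, hres, hns⟩ hirr hodd hunr hdR hcpt ι

/-- The sibling support IS the cell on `oddPrimePred`. -/
theorem oddPrimesRegularFM_iff :
    DyadicOddResidue.OddPrimesRegularFM ↔ RegularFMCellOn oddPrimePred := by
  constructor
  · intro h ℓ _ ρ hP hirr hodd hunr hdR hcpt ι
    exact h ℓ hP ρ hirr hodd hunr hdR hcpt ι
  · intro h ℓ _ hℓ ρ hirr hodd hunr hdR hcpt ι
    exact h ℓ ρ hℓ hirr hodd hunr hdR hcpt ι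

/-- … and the landed fact `XZhang2024_fontaineMazurGL2_tateTwist` IS `TateTwistModularityOn` on
the odd cell. -/
theorem tateTwistModularityOn_odd_of_fact (h : XZhang2024_fontaineMazurGL2_tateTwist) :
    TateTwistModularityOn oddPrimePred :=
  fun p _ ρ hp hunr hirr hodd hdR => h p hp ρ hunr hirr hodd hdR

/-! ## 4. The proposed p = 2 named fact (Tung, Math. Z. 298 (2021), Thm. 1.1) and its residual
hypothesis in Serre's vocabulary -/

/-- **"`ρ̄` is modular"** (Serre (3.2.3) for SOME residual representation of `ρ`): there are an
algebraically closed field `k` of characteristic `p` (discrete), a residue embedding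
`ι : ℤ̄_p/𝔪 → k`, a continuous `τ : Γ_ℚ → GL₂(k)` which is a residual representation of `ρ`
along `ι` (`IsResidualRepOf`: semisimplification of a reduction), a newform `g ∈ S_w(Γ₁(N))` and
`ι_g : 𝓞_g → k` with `charpoly τ(Frob_q) = ι_g(X² - a_q(g) X + ε_g(q) q^{w-1})` for `q ∤ N p`
(`IsGaloisRepOfNewform1Int`, the conclusion shape of the tree's `khare_wintenberger` /
`exists_newform_of_odd_irreducible`). -/
def IsResiduallySerreModular (p : ℕ) [Fact p.Prime] (ρ : FramedGaloisRep ℚ (PadicAlgCl p) 2) :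
    Prop :=
  ∃ (k : Type) (_ : Field k) (_ : TopologicalSpace k) (_ : DiscreteTopology k) (_ : CharP k p)
    (_ : IsAlgClosed k) (ι : padicAlgClResidueField p →+* k) (τ : FramedGaloisRep ℚ k 2),
    ρ.IsResidualRepOf ι (τ : absoluteGaloisGroup ℚ →* GL (Fin 2) k) ∧
    ∃ (N : ℕ) (_ : NeZero N) (w : ℤ) (g : CuspForm (Gamma1 N) w)
      (ιg : coeffCharIntegers g →+* k),
      IsNewform1 g ∧ IsGaloisRepOfNewform1Int g ιg {q | q ∣ N * p} τ

/-- **PROPOSED NAMED FACT (to vendor in `Literature/NumberTheory/Automorphic/`, topic of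
`FontaineMazurGL2OddPrimeTateTwist`): Tung, Math. Z. 298 (2021) 107–159 = arXiv:1908.06174,
Thm. 1.1 (= "Theorem 1", p. 4 L7–16: "Assume p = 2. Let ρ be as in the conjecture … • ρ|G_ℚ₂
has distinct Hodge–Tate weights. • ρ̄ is modular. • ρ̄ has non-solvable image. Then ρ is
modular"), with "ρ is modular" in the reading the paper's own proof prints — Def. §3 p. 12 L52
("ρ automorphic … ρ ≅ ρ_{π,ι}", `π` regular algebraic cuspidal on `GL₂(𝔸_F)`) and Thm. 8.0.4
p. 32 with its proof ("ρ|_{G_{F'}} is automorphic", solvable descent), i.e. a TATE twist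
`ρ ⊗ ε₂^m` is the Galois representation of a newform — VERBATIM the p = 2 twin of the accepted
`XZhang2024_fontaineMazurGL2_tateTwist`, with Tung's two residual hypotheses added: `ρ̄` modular
(`IsResiduallySerreModular`, Serre's (3.2.3) vocabulary of `SerreConjecture.lean`) and `ρ̄` with
non-solvable image (`¬ IsSolvable ρ.residualRep.range`, the crux's own clause). -/
def Tung2020_fontaineMazurGL2_two_tateTwist : Prop :=
  ∀ (p : ℕ) [Fact p.Prime], p = 2 →
    ∀ (ρ : FramedGaloisRep ℚ (PadicAlgCl p) 2),
      (∀ᶠ v : HeightOneSpectrum (𝓞 ℚ) in cofinite, ρ.IsUnramifiedAt v) →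
      ρ.toGaloisRep.IsIrreducible → ρ.IsOdd →
      IsResiduallySerreModular p ρ → ¬ IsSolvable ρ.residualRep.range →
      (∀ (v : HeightOneSpectrum (𝓞 ℚ)) (hv : ((p : ℕ) : 𝓞 ℚ) ∈ v.asIdeal),
        (PAdicHodge.fontainePstAdicCompletion v p hv).IsDeRhamFramed (ρ.toLocal v) ∧
        ∀ τ : v.adicCompletion ℚ →+* PadicAlgCl p, Continuous τ →
          (ρ.labelledHodgeTateWeightsAt v (PAdicHodge.fontainePstAdicCompletion v p hv).algebra
            (PAdicHodge.fontainePstAdicCompletion v p hv).𝔅 τ).Nodup) →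
      ∃ (χ : absoluteGaloisGroup ℚ →ₜ* (PadicAlgCl p)ˣ) (m : ℤ),
        (∀ σ, χ σ = cyclotomicPadicAlgCl ℚ p σ ^ m) ∧
        ∃ (N : ℕ) (_ : NeZero N) (k : ℤ) (f : CuspForm (Gamma1 N) k)
          (ιf : coeffCharField f →+* PadicAlgCl p),
          IsNewform1 f ∧ IsGaloisRepOfNewform1 f ιf {q | q ∣ N * p} (FramedRep.twist ρ χ)

/-! ## 5. The residual bridge B1 (stub, size M) and its two proved ingredients -/

/-- **Non-solvability certifies the chosen residual representation.**  `residualRep` has junk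
value `1` when no semisimplified reduction exists; the range of `1` is `⊥`, which is solvable —
so the crux's own hypothesis `¬ IsSolvable ρ.residualRep.range` forces the genuine branch, with
no appeal to the rank-two existence theorem. (PROVED.) -/
theorem isResidualRepOf_residualRep_of_not_isSolvable {ℓ : ℕ} [Fact ℓ.Prime] {K : Type}
    [Field K] {n : ℕ} (ρ : FramedGaloisRep K (PadicAlgCl ℓ) n)
    (h : ¬ IsSolvable ρ.residualRep.range) :
    ρ.IsResidualRepOf (RingHom.id _) ρ.residualRep := by
  apply FramedGaloisRep.residualRep_spec
  by_contra hne
  apply h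
  have h1 : ρ.residualRep = 1 := by
    rw [FramedGaloisRep.residualRep, dif_neg hne]
  rw [h1, MonoidHom.range_one]
  infer_instance

/-- **Oddness is free in characteristic two**: `det τ(c) = -1` for every complex conjugation `c`,
because `c² = 1` forces `det τ(c)² = 1`, hence `(det τ(c) - 1)² = 0` and `det τ(c) = 1 = -1`.
(PROVED; this is why `khare_wintenberger 2 k` applies to every residual representation.) -/
theorem isOdd_of_charP_two {k : Type} [Field k] [CharP k 2] [TopologicalSpace k]
    (τ : FramedGaloisRep ℚ k 2) : τ.IsOdd := by
  intro φ c hc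
  have hc2 : τ c * τ c = 1 := by rw [← map_mul, ← sq, hc.sq_eq_one, map_one]
  set d : kˣ := Matrix.GeneralLinearGroup.det (τ c) with hd
  have hd2 : d * d = 1 := by rw [hd, ← map_mul, hc2, map_one]
  have hneg : (-1 : kˣ) = 1 := by
    ext; simp [CharTwo.neg_eq]
  rw [hneg]
  ext
  have hdk : (d : k) * (d : k) = 1 := by
    have := congrArg Units.val hd2
    simpa using this
  have hsq : ((d : k) - 1) ^ 2 = 0 := by
    have h2 : (2 : k) = 0 := CharTwo.two_eq_zero
    linear_combination hdk + (1 - (d : k)) * h2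
  have := pow_eq_zero_iff (two_ne_zero) |>.1 hsq
  rw [Units.val_one]
  exact sub_eq_zero.1 this

/-- **STUB B1 — the Khare–Wintenberger residual bridge at `p = 2`.**  From the tree's named fact
`khare_wintenberger 2 k` (Serre's conjecture, strong form; all `p` incl. `2`) and non-solvability
of `ρ̄`: push `ρ.residualRep` (genuine: `isResidualRepOf_residualRep_of_not_isSolvable`) into
`k := ℤ̄₂/𝔪` with the discrete topology (algebraically closed: `isAlgClosed_residueField`;
characteristic `2`: `charP_padicAlgClResidueField`), continuous because a reduction has open kernel
(`isOpen_ker_residualRep`) and a semisimplification's kernel contains it; irreducible because a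
reducible `τ` over an algebraically closed field has upper-triangular, hence solvable, image;
odd for free (`isOdd_of_charP_two`); then `exists_newform_of_odd_irreducible_of_khare_wintenberger`. -/
theorem stub_isResiduallySerreModular_of_khare_wintenberger (p : ℕ) [Fact p.Prime] (hp : p = 2)
    (hKW : ∀ (k : Type) [Field k] [TopologicalSpace k] [DiscreteTopology k],
      khare_wintenberger p k)
    (ρ : FramedGaloisRep ℚ (PadicAlgCl p) 2) (hns : ¬ IsSolvable ρ.residualRep.range) :
    IsResiduallySerreModular p ρ := by
  sorry

/-! ## 6. The glue: the crux BY NAME from (conversion stub) + (p = 2 fact) + (B1) — PROVED -/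

/-- `TateTwistModularityOn` on the dyadic non-solvable cell from the proposed fact and B1. -/
theorem tateTwistModularityOn_dyadic_of_fact (hfact : Tung2020_fontaineMazurGL2_two_tateTwist)
    (hB1 : ∀ (p : ℕ) [Fact p.Prime], p = 2 → ∀ ρ : FramedGaloisRep ℚ (PadicAlgCl p) 2,
      ¬ IsSolvable ρ.residualRep.range → IsResiduallySerreModular p ρ) :
    TateTwistModularityOn dyadicNonsolvablePred := by
  intro p _ ρ hP hunr hirr hodd hdR
  obtain ⟨hp, -, hns⟩ := hP
  exact hfact p hp ρ hunr hirr hodd (hB1 p hp ρ hns) hns hdR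

/-- **The composition** (kernel-checked, no `sorry` here): the crux `DyadicNonsolvableFM` follows
from the conversion stub on its cell, the proposed `p = 2` fact, and B1 fed by
`khare_wintenberger 2 k` for all discrete `k`.  Trust base of the finished line:
`{Tung2020_fontaineMazurGL2_two_tateTwist, khare_wintenberger}`. -/
theorem dyadicNonsolvableFM_of_line
    (hconv : TateTwistModularityOn dyadicNonsolvablePred → RegularFMCellOn dyadicNonsolvablePred)
    (hfact : Tung2020_fontaineMazurGL2_two_tateTwist)
    (hKW : ∀ (p : ℕ) [Fact p.Prime] (k : Type) [Field k] [TopologicalSpace k] [DiscreteTopology k],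
      khare_wintenberger p k)
    (hB1 : ∀ (p : ℕ) [Fact p.Prime], p = 2 →
      (∀ (k : Type) [Field k] [TopologicalSpace k] [DiscreteTopology k], khare_wintenberger p k) →
      ∀ ρ : FramedGaloisRep ℚ (PadicAlgCl p) 2,
        ¬ IsSolvable ρ.residualRep.range → IsResiduallySerreModular p ρ) :
    DyadicOddResidue.DyadicNonsolvableFM := by
  rw [dyadicNonsolvableFM_iff]
  exact hconv (tateTwistModularityOn_dyadic_of_fact hfact fun p _ hp ρ hns => hB1 p hp (hKW p) ρ hns)

/-- The same composition with the two stubs plugged in (so `lean check` reports exactly the two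
`sorry`s of the line and nothing else). -/
theorem dyadicNonsolvableFM_of_stubs (hfact : Tung2020_fontaineMazurGL2_two_tateTwist)
    (hKW : ∀ (p : ℕ) [Fact p.Prime] (k : Type) [Field k] [TopologicalSpace k] [DiscreteTopology k],
      khare_wintenberger p k) :
    DyadicOddResidue.DyadicNonsolvableFM :=
  dyadicNonsolvableFM_of_line (stub_regularFMCellOn_of_tateTwistModularityOn _) hfact hKW
    (fun p _ hp h ρ hns => stub_isResiduallySerreModular_of_khare_wintenberger p hp h ρ hns)

/-! ## 7. The twin cell of route `OddResidueBelowFive` (PROVED direction; for the record)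

`KnownTwoAdicBigImage` (stmt-Langlands-18719) asks the same conclusion under `ρ̄` absolutely
irreducible and NOT of dihedral type.  It is the STRONGER statement: reaching it from Tung's
"non-solvable image" needs Dickson's classification in characteristic `2` (irreducible and not
dihedral ⇒ projective image `⊇ PSL₂(𝔽_{2^r})`, `r ≥ 2`), whereas our crux follows from it by the
elementary "non-solvable ⇒ not dihedral" (dihedral groups are solvable and the projective image
is the image modulo a central subgroup).  So THIS crux is upstream: prove it from the fact, and
let the twin's prover add Dickson. -/
theorem dyadicNonsolvableFM_of_knownTwoAdicBigImage
    (hdih : ∀ ρ : FramedGaloisRep ℚ (PadicAlgCl 2) 2,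
      ¬ IsSolvable ρ.residualRep.range → ¬ IsDihedralType ρ.residualRep)
    (h : OddResidueBelowFive.KnownTwoAdicBigImage) : DyadicOddResidue.DyadicNonsolvableFM := by
  intro ℓ _ hℓ ρ hres hns hirr hodd hunr hdR hcpt ι
  subst hℓ
  exact h ρ hodd hirr hunr hdR hres (hdih ρ hns) ι hcpt

end Summit.Langlands.Langlands.Cruxes.DyadicNonsolvableFM.TateTwistCellTransplant

end
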